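import Literature.MathematicalPhysics.QuantumFieldTheory.Balaban1983to89.T4WordSystemGaugeBound

/-!
# `Balaban1983to89.T4StairWordSystemCubeTreeCut` — THE CUT FACE OF A NON-TREE COMPONENT: across a face that the tree of boxes does NOT glue, the gauged bond variables are
# PAIRWISE CLOSE («flat up to a locally constant twist on one cut»), by the plaquette LADDER along the face — [Balaban1985Averaging] (19)–(20) bookkeeping

Cell `pub-ymgap` (Track A DAG, node N12 = [B15] = T. Bałaban, *Large field renormalization. I*, Commun. Math. Phys. **122** (1989) 175–202 [Balaban1989LargeFieldI]),
width seat `dag-n12-w2` (g5); the gauge-side input of the lane owner's LOCATED-GEOM v3 memo §2 (X2)(ii) (dag-n12-c g19, `N12-GEOM-V3-MEMO.md`: *«on a ring the datum's holonomy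
defect can be gauged onto ONE cut; components whose tower crosses the cut compare with Φ♭ twisted by the constant h»*).  Count-neutral Literature helper.  HONEST FRAMING:
elementary group bookkeeping (`|XY − 1| ≤ |X − 1| + |Y − 1|`, `|gXg⁻¹ − 1| = |X − 1|`) on the tree's own objects; nothing of Bałaban's estimates is asserted; N12 is NOT
discharged by this file; one finite `𝕋⁴` programme at fixed `ε`; nothing here bears on the continuum ∕ OS ∕ mass-gap statement.

THE POINT.  In the tree-of-boxes gauge `u` of `T4StairWordSystemCubeTree{,Glue,Induction}` every bond with both ends in ONE box, and every bond across a GLUED face, is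
`K·δ`-near `1`.  A ring-shaped region is a tree of boxes plus ONE more lattice adjacency (the CUT face) which the tree does not glue; there the gauged bond variables carry the
ring's holonomy and cannot be near `1` (dag-n12-c's `B15Prop1HolonomyObstruction`).  What IS true, and all that a «flat reference with a constant twist `h`» needs on the gauge
side: two parallel cut bonds that are opposite sides of a plaquette differ by that plaquette and the two rungs — `V(b₁)·V(b₂)⁻¹ = U(∂p)·Y·(B X⁻¹ B⁻¹)` — so
`dist1 (V(b₁)·V(b₂)⁻¹) ≤ dist1 (V(∂p)) + dist1 (rung₁) + dist1 (rung₂)`; along a path of `ℓ` steps inside the cut face the cut-bond variables are pairwise within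
`ℓ·(δ_p + 2ε_r)` (plaquettes `δ_p`-small — gauge invariant —, rungs `ε_r`-near `1` — they are in-box bonds of the two boxes on either side of the cut).

WHAT IS PROVED (no `def`, no `sorry`; `G` any `GaugeGroup`, any field `V`): §1 `dist1_bond_mul_inv_le_of_plaq` (the two `p.μ`-bonds of a plaquette), `dist1_bond_mul_inv_le_of_plaq'`
(the two `p.ν`-bonds); §2 ★★ `dist1_bond_mul_inv_le_of_facePath` — along any lattice word `z` avoiding the direction `μ`, `dist1 (V⟨x,μ⟩·V⟨walkEnd x z, μ⟩⁻¹) ≤ |z|·(δ_p + 2ε_r)`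
under the displayed plaquette and rung letters at the steps of `walk x z`.

References: T. Bałaban, CMP 98 (1985) 17–51 [Balaban1985Averaging] ((8)–(9) p.19, (19)–(20) p.21); CMP 122 (1989) 175–202 [Balaban1989LargeFieldI] (p.194).
-/

noncomputable section

namespace Literature.MathematicalPhysics.QuantumFieldTheory.Balaban1983to89.T4StairWordSystemCubeTreeCut

open T4Continuum T4ReflectionCone

variable {P : Params} {j : ℕ} {G : Type*} [GaugeGroup G]

/-! ## §1 The plaquette ladder: opposite bonds of one plaquette -/

/-- **THE LADDER RUNG, `p.μ`-BONDS**: the two bonds of a plaquette `p` in the direction `p.μ` (at `p.src` and at `p.src + e_{p.ν}`) satisfy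
`V⟨src,μ⟩·V⟨src+e_ν,μ⟩⁻¹ = V(∂p)·V⟨src,ν⟩·(V⟨src+e_ν,μ⟩·V⟨src+e_μ,ν⟩⁻¹·V⟨src+e_ν,μ⟩⁻¹)`, hence `dist1 ≤ dist1 (V(∂p)) + dist1 (V⟨src,ν⟩) + dist1 (V⟨src+e_μ,ν⟩)`. [cite: Balaban1985Averaging, (9) p.19 and (19)-(20) p.21] -/
theorem dist1_bond_mul_inv_le_of_plaq (V : GaugeField P j G) (p : Plaq P j) :
    dist1 (V ⟨p.src, p.μ⟩ * (V ⟨p.src.shift p.ν, p.μ⟩)⁻¹)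
      ≤ dist1 (GaugeField.plaqHol V p) + dist1 (V ⟨p.src, p.ν⟩) + dist1 (V ⟨p.src.shift p.μ, p.ν⟩) := by
  have key : V ⟨p.src, p.μ⟩ * (V ⟨p.src.shift p.ν, p.μ⟩)⁻¹ =
      GaugeField.plaqHol V p * V ⟨p.src, p.ν⟩ *
        (V ⟨p.src.shift p.ν, p.μ⟩ * (V ⟨p.src.shift p.μ, p.ν⟩)⁻¹ * (V ⟨p.src.shift p.ν, p.μ⟩)⁻¹) := by
    simp only [GaugeField.plaqHol]; group
  rw [key]
  calc dist1 (GaugeField.plaqHol V p * V ⟨p.src, p.ν⟩ * (V ⟨p.src.shift p.ν, p.μ⟩ * (V ⟨p.src.shift p.μ, p.ν⟩)⁻¹ * (V ⟨p.src.shift p.ν, p.μ⟩)⁻¹))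
      ≤ dist1 (GaugeField.plaqHol V p * V ⟨p.src, p.ν⟩) + dist1 (V ⟨p.src.shift p.ν, p.μ⟩ * (V ⟨p.src.shift p.μ, p.ν⟩)⁻¹ * (V ⟨p.src.shift p.ν, p.μ⟩)⁻¹) :=
        GaugeGroup.dist1_mul_le _ _
    _ ≤ (dist1 (GaugeField.plaqHol V p) + dist1 (V ⟨p.src, p.ν⟩)) + dist1 (V ⟨p.src.shift p.μ, p.ν⟩) := by
        rw [GaugeGroup.dist1_conj, GaugeGroup.dist1_inv]; exact add_le_add (GaugeGroup.dist1_mul_le _ _) le_rfl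

/-- **THE LADDER RUNG, `p.ν`-BONDS**: the two bonds of `p` in the direction `p.ν` (at `p.src` and at `p.src + e_{p.μ}`):
`V⟨src,ν⟩·V⟨src+e_μ,ν⟩⁻¹ = V(∂p)⁻¹·V⟨src,μ⟩·(V⟨src+e_μ,ν⟩·V⟨src+e_ν,μ⟩⁻¹·V⟨src+e_μ,ν⟩⁻¹)`, hence `dist1 ≤ dist1 (V(∂p)) + dist1 (V⟨src,μ⟩) + dist1 (V⟨src+e_ν,μ⟩)`. [cite: Balaban1985Averaging, (9) p.19 and (19)-(20) p.21] -/
theorem dist1_bond_mul_inv_le_of_plaq' (V : GaugeField P j G) (p : Plaq P j) :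
    dist1 (V ⟨p.src, p.ν⟩ * (V ⟨p.src.shift p.μ, p.ν⟩)⁻¹)
      ≤ dist1 (GaugeField.plaqHol V p) + dist1 (V ⟨p.src, p.μ⟩) + dist1 (V ⟨p.src.shift p.ν, p.μ⟩) := by
  have key : V ⟨p.src, p.ν⟩ * (V ⟨p.src.shift p.μ, p.ν⟩)⁻¹ =
      (GaugeField.plaqHol V p)⁻¹ * V ⟨p.src, p.μ⟩ *
        (V ⟨p.src.shift p.μ, p.ν⟩ * (V ⟨p.src.shift p.ν, p.μ⟩)⁻¹ * (V ⟨p.src.shift p.μ, p.ν⟩)⁻¹) := by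
    simp only [GaugeField.plaqHol]; group
  rw [key]
  calc dist1 ((GaugeField.plaqHol V p)⁻¹ * V ⟨p.src, p.μ⟩ * (V ⟨p.src.shift p.μ, p.ν⟩ * (V ⟨p.src.shift p.ν, p.μ⟩)⁻¹ * (V ⟨p.src.shift p.μ, p.ν⟩)⁻¹))
      ≤ dist1 ((GaugeField.plaqHol V p)⁻¹ * V ⟨p.src, p.μ⟩) + dist1 (V ⟨p.src.shift p.μ, p.ν⟩ * (V ⟨p.src.shift p.ν, p.μ⟩)⁻¹ * (V ⟨p.src.shift p.μ, p.ν⟩)⁻¹) :=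
        GaugeGroup.dist1_mul_le _ _
    _ ≤ (dist1 (GaugeField.plaqHol V p) + dist1 (V ⟨p.src, p.μ⟩)) + dist1 (V ⟨p.src.shift p.ν, p.μ⟩) := by
        rw [GaugeGroup.dist1_conj, GaugeGroup.dist1_inv]
        refine add_le_add ((GaugeGroup.dist1_mul_le _ _).trans ?_) le_rfl
        rw [GaugeGroup.dist1_inv]

/-! ## §2 ★★ Along a path inside the cut face -/

/-- One step of the face path: the bond `⟨x, μ⟩` and its translate by `±e_κ`, `κ ≠ μ`, differ by the plaquette spanned by `μ` and `κ` at the appropriate corner and its two `κ`-rungs.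
Stated for the FORWARD step `x ↦ x + e_κ`: `dist1 (V⟨x,μ⟩·V⟨x+e_κ,μ⟩⁻¹) ≤ δ_p + 2ε_r` if the plaquette at `x` in the plane `{μ, κ}` is `δ_p`-small and the rungs `⟨x,κ⟩`, `⟨x+e_μ,κ⟩` are
`ε_r`-near `1`. [cite: Balaban1985Averaging, (9) p.19 and (19)-(20) p.21] -/
theorem dist1_bond_mul_inv_shift_le (V : GaugeField P j G) (x : Site P j) {μ κ : Fin P.d} (hκ : κ ≠ μ) {δp εr : ℝ}
    (hplaq : ∀ (a b : Fin P.d) (hab : a < b), (a = μ ∧ b = κ) ∨ (a = κ ∧ b = μ) → dist1 (GaugeField.plaqHol V ⟨x, a, b, hab⟩) ≤ δp)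
    (hr1 : dist1 (V ⟨x, κ⟩) ≤ εr) (hr2 : dist1 (V ⟨x.shift μ, κ⟩) ≤ εr) :
    dist1 (V ⟨x, μ⟩ * (V ⟨x.shift κ, μ⟩)⁻¹) ≤ δp + 2 * εr := by
  rcases lt_or_gt_of_ne hκ with h | h
  · -- `κ < μ`: the plaquette `⟨x, κ, μ⟩`, the `μ`-bonds are its `ν`-bonds
    have := dist1_bond_mul_inv_le_of_plaq' V ⟨x, κ, μ, h⟩
    have hp := hplaq κ μ h (Or.inr ⟨rfl, rfl⟩)
    simp only at this
    linarith
  · -- `μ < κ`: the plaquette `⟨x, μ, κ⟩`, the `μ`-bonds are its `μ`-bonds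
    have := dist1_bond_mul_inv_le_of_plaq V ⟨x, μ, κ, h⟩
    have hp := hplaq μ κ h (Or.inl ⟨rfl, rfl⟩)
    simp only at this
    linarith

/-- ★★ **THE CUT-BOND VARIABLES ARE PAIRWISE CLOSE ALONG THE FACE**: for a word `z` avoiding the direction `μ` (a path inside the cut face from `x`), if at every step `st` of `walk x z`
the two plaquettes-candidates at `st.bond.src` in the plane `{μ, dir st}` are `δ_p`-small and the rungs `st.bond`, `st.bond + e_μ` are `ε_r`-near `1`, then
`dist1 (V⟨x,μ⟩ · V⟨walkEnd x z, μ⟩⁻¹) ≤ |z|·(δ_p + 2ε_r)` — «the twist is locally constant on the cut». [cite: Balaban1985Averaging, (9) p.19 and (19)-(20) p.21] -/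
theorem dist1_bond_mul_inv_le_of_facePath (V : GaugeField P j G) (μ : Fin P.d) {δp εr : ℝ} (hδp : 0 ≤ δp) (hεr : 0 ≤ εr) :
    ∀ (x : Site P j) (z : List (Letter P.d)), (∀ l ∈ z, l.1 ≠ μ) →
      (∀ st ∈ walk x z, ∀ (a b : Fin P.d) (hab : a < b), (a = μ ∧ b = st.bond.dir) ∨ (a = st.bond.dir ∧ b = μ) →
        dist1 (GaugeField.plaqHol V ⟨st.bond.src, a, b, hab⟩) ≤ δp) →
      (∀ st ∈ walk x z, dist1 (V st.bond) ≤ εr ∧ dist1 (V ⟨st.bond.src.shift μ, st.bond.dir⟩) ≤ εr) →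
      dist1 (V ⟨x, μ⟩ * (V ⟨walkEnd x z, μ⟩)⁻¹) ≤ z.length * (δp + 2 * εr)
  | x, [], _, _, _ => by simp [walkEnd, GaugeGroup.dist1_one]
  | x, (κ, true) :: z, hz, hplaq, hrung => by
    have hκ : κ ≠ μ := hz (κ, true) (by simp)
    have hstep : (⟨⟨x, κ⟩, true⟩ : LStep P j) ∈ walk x ((κ, true) :: z) := by simp [walk]
    have h1 := dist1_bond_mul_inv_shift_le V x hκ (hplaq _ hstep) (hrung _ hstep).1 (hrung _ hstep).2
    have ih := dist1_bond_mul_inv_le_of_facePath V μ hδp hεr (x.shift κ) z (fun l hl => hz l (List.mem_cons_of_mem _ hl))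
      (fun st hst => hplaq st (by simp [walk, hst])) (fun st hst => hrung st (by simp [walk, hst]))
    rw [walkEnd, List.length_cons]
    have e1 : V ⟨x, μ⟩ * (V ⟨walkEnd (x.shift κ) z, μ⟩)⁻¹ =
        (V ⟨x, μ⟩ * (V ⟨x.shift κ, μ⟩)⁻¹) * (V ⟨x.shift κ, μ⟩ * (V ⟨walkEnd (x.shift κ) z, μ⟩)⁻¹) := by group
    rw [e1]
    calc dist1 ((V ⟨x, μ⟩ * (V ⟨x.shift κ, μ⟩)⁻¹) * (V ⟨x.shift κ, μ⟩ * (V ⟨walkEnd (x.shift κ) z, μ⟩)⁻¹))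
        ≤ dist1 (V ⟨x, μ⟩ * (V ⟨x.shift κ, μ⟩)⁻¹) + dist1 (V ⟨x.shift κ, μ⟩ * (V ⟨walkEnd (x.shift κ) z, μ⟩)⁻¹) := GaugeGroup.dist1_mul_le _ _
      _ ≤ (δp + 2 * εr) + z.length * (δp + 2 * εr) := add_le_add h1 ih
      _ = ((z.length + 1 : ℕ) : ℝ) * (δp + 2 * εr) := by push_cast; ring
  | x, (κ, false) :: z, hz, hplaq, hrung => by
    have hκ : κ ≠ μ := hz (κ, false) (by simp)
    have hstep : (⟨⟨x.unshift κ, κ⟩, false⟩ : LStep P j) ∈ walk x ((κ, false) :: z) := by simp [walk]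
    have hsu : (x.unshift κ).shift κ = x := Site.shift_unshift x κ
    have h1 := dist1_bond_mul_inv_shift_le V (x.unshift κ) hκ (hplaq _ hstep) (hrung _ hstep).1 (hrung _ hstep).2
    rw [hsu] at h1
    have ih := dist1_bond_mul_inv_le_of_facePath V μ hδp hεr (x.unshift κ) z (fun l hl => hz l (List.mem_cons_of_mem _ hl))
      (fun st hst => hplaq st (by simp [walk, hst])) (fun st hst => hrung st (by simp [walk, hst]))
    rw [walkEnd, List.length_cons]
    have e1 : V ⟨x, μ⟩ * (V ⟨walkEnd (x.unshift κ) z, μ⟩)⁻¹ =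
        (V ⟨x.unshift κ, μ⟩ * (V ⟨x, μ⟩)⁻¹)⁻¹ * (V ⟨x.unshift κ, μ⟩ * (V ⟨walkEnd (x.unshift κ) z, μ⟩)⁻¹) := by group
    rw [e1]
    calc dist1 ((V ⟨x.unshift κ, μ⟩ * (V ⟨x, μ⟩)⁻¹)⁻¹ * (V ⟨x.unshift κ, μ⟩ * (V ⟨walkEnd (x.unshift κ) z, μ⟩)⁻¹))
        ≤ dist1 (V ⟨x.unshift κ, μ⟩ * (V ⟨x, μ⟩)⁻¹)⁻¹ + dist1 (V ⟨x.unshift κ, μ⟩ * (V ⟨walkEnd (x.unshift κ) z, μ⟩)⁻¹) := GaugeGroup.dist1_mul_le _ _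
      _ ≤ (δp + 2 * εr) + z.length * (δp + 2 * εr) := by rw [GaugeGroup.dist1_inv]; exact add_le_add h1 ih
      _ = ((z.length + 1 : ℕ) : ℝ) * (δp + 2 * εr) := by push_cast; ring

end Literature.MathematicalPhysics.QuantumFieldTheory.Balaban1983to89.T4StairWordSystemCubeTreeCut

end
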